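import Literature.NumberTheory.EllipticCurves.EisensteinNumbersRationality
import Mathlib.FieldTheory.IntermediateField.Adjoin.Defs
import Mathlib.Analysis.Calculus.Deriv.Shift
import HarnessLib

/-!
# Rationality of ALL higher logarithmic derivatives of `Θ(z; L, 𝔞)` at a point
# (de Shalit II.3.3 (ii) for the combinations `E_k(v; L, 𝔞)`, every `k ≥ 1` — elementary core)

Topic `Literature/NumberTheory/EllipticCurves` (complex-lattice cluster); theorems only, deliberate
dot-notation extensions of Mathlib's `PeriodPair`, continuing `EisensteinNumbers.lean` (II.3.1 (7):
`(d/dz)^m((d/dz) log Θ(·; L, S))(z) = 12(−1)^m(N E_{m+1}(z, Λ) − E_{m+1}(z, Λ'))`, and the `k = 2` form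
`−12(N℘_Λ(z) − ℘_{Λ'}(z) − Σ_{c≠0}℘_Λ(c))`), `EllipticUnitTheta.lean` (`Θ′/Θ(z) = −6Σ_{c≠0}℘′(z)/(℘(z) − ℘(c))`)
and `EisensteinNumbersRationality.lean` (`E_k(v, L) ∈ ℚ[g₂, g₃, ℘(v), ℘′(v)]`, `k ≥ 3`).

de Shalit II.3.3 (ii) [p0050]: "`E_{j,k}(v,L) ∈ K(l.c.m.(𝔣,𝔪))`", proof: "By (7), `E_k(z;L,𝔞)` is an
`F`-rational elliptic function, so `E_k(v;L,𝔞) ∈ K(𝔤)`"; II.4.9 [p0062]: "the elliptic function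
`Θ(Ω−z;L,𝔞)` is defined over `F`, hence `P(z)` indeed belongs to `F[[z]]`". The ELEMENTARY content,
proved here WITHOUT complex multiplication and for EVERY order (including the weights `1` and `2`, where
the single numbers `E₁ = ζ − η`, `E₂ = ℘ + s₂` are transcendental in general but the non-algebraic parts
CANCEL in the combination `N·E_k(z, Λ) − E_k(z, Λ')`): for lattices `Λ ⊆ Λ'` with representatives
`S ∋ 0` and `z ∉ Λ'`, every Taylor coefficient at `z` of `(d/dz) log Θ(·; L, S)` lies in ANY subfield
`F′ ⊆ ℂ` containing `g₂, g₃` of BOTH lattices, the coordinates `℘(z), ℘′(z)` of `z` on BOTH curves, and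
the `x`-coordinates `℘_Λ(c)` of the nonzero representatives (the `𝔞`-torsion points):

* `PeriodPair.iteratedDeriv_logDeriv_ellipticTheta_mem` — `(d/dz)^m(Θ′/Θ)(z) ∈ F′` for all `m`;
* `PeriodPair.sub_eisensteinE_mem` — `N·E_k(z, Λ) − E_k(z, Λ') ∈ F′` for all `k ≥ 1`
  (= `(−1)^{k−1}/12 · (d/dz)^{k−1}(Θ′/Θ)(z)`);
* the same for de Shalit's normalisation `PeriodPair.deShalitTheta` and for the generated field
  `ℚ(g₂, g₃, g₂′, g₃′, ℘(z), ℘′(z), ℘'(z)…)` (`IntermediateField.adjoin`);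
* ★ `PeriodPair.iteratedDeriv_logDeriv_ellipticTheta_comp_sub` — **the form used in II.4.10 (26)**:
  `(d/dz)^m((d/dz) log Θ(Ω − z; L, S))(v) = −12·(N·E_{m+1}(Ω − v, Λ) − E_{m+1}(Ω − v, Λ'))`, i.e.
  `(d/dz)^k log Θ(Ω − z; L, 𝔞)|_{z=v} = −12·E_k(Ω − v; L, 𝔞)` with NO sign (the two factors `(−1)^m`
  from `z ↦ Ω − z` and from `∂ = −d/dz` cancel) — de Shalit's "`= −12·Ω_p^k·E_k(Ω − v_n; L, 𝔞)`" read
  on the complex side.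

So the expansion `P(z)` of II.4.9 has, up to its constant term `Θ(Ω)`, coefficients in that field; the
identification of the field with `K(l.c.m.(𝔣, 𝔪))` (II.1.6, CM theory) is NOT claimed.

References: E. de Shalit (1987), II.3.1 (7), II.3.3 (ii), II.4.9 [deShalit1987]; K. Rubin, LNM 1716, Thm.
7.13 [Rubin1999].

Mathlib / tree search: tree `logDeriv_ellipticTheta_eq_sum`, `deriv_logDeriv_ellipticTheta`,
`iteratedDeriv_logDeriv_ellipticTheta`, `eisensteinE_mem_of_mem`, `weierstrassP_ne_of_reps`,
`deShalitTheta_def`; Mathlib `IntermediateField.adjoin`, `IntermediateField.subset_adjoin`.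
-/

noncomputable section

open Complex

namespace PeriodPair

variable {L L' : PeriodPair} {S : Finset ℂ} {F : IntermediateField ℚ ℂ}

section Reps

variable (hS : ∀ x, x ∈ L'.lattice ↔ ∃ c ∈ S, x - c ∈ L.lattice) (hS0 : (0 : ℂ) ∈ S)
  (hSd : ∀ c ∈ S, ∀ c' ∈ S, c - c' ∈ L.lattice → c = c')
include hS hS0 hSd

/-- **Order `0`: `Θ′/Θ(z) = −6Σ_{c≠0}℘′(z)/(℘(z) − ℘(c)) ∈ F′`** whenever `℘(z), ℘′(z), ℘(c) ∈ F′`.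
[cite: deShalit1987, II.3.3 (ii)] [cite: Rubin1999, §7.4 Thm. 7.13 (proof)] -/
theorem logDeriv_ellipticTheta_mem {z : ℂ} (hz : z ∉ L'.lattice) (hx : ℘[L] z ∈ F) (hy : ℘'[L] z ∈ F)
    (hc : ∀ c ∈ S.erase 0, ℘[L] c ∈ F) : logDeriv (L.ellipticTheta S) z ∈ F := by
  rw [logDeriv_ellipticTheta_eq_sum hS hS0 hSd hz]
  refine mul_mem (neg_mem (by exact_mod_cast natCast_mem F 6)) (sum_mem fun c hcS ↦ ?_)
  exact div_mem hy (sub_mem hx (hc c hcS))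

/-- **The holomorphic combinations `N·E_k(z, Λ) − E_k(z, Λ')` are `F′`-rational for EVERY `k ≥ 1`**
(`z ∉ Λ'`; `F′ ∋ g₂, g₃, g₂′, g₃′, ℘(z), ℘′(z), ℘'(z), ℘'′(z), ℘(c)`): weight `1` is `Θ′/(12Θ)`, weight `2` is
`−(N℘(z) − ℘'(z) − Σ_{c≠0}℘(c))`, weights `≥ 3` are `E_k = (−1)^k℘^{(k−2)}` on each curve — the
transcendental `η`, `s₂` cancel. [cite: deShalit1987, II.3.3 (ii), II.3.1 (5)–(7)] -/
theorem sub_eisensteinE_mem {z : ℂ} (hz : z ∉ L'.lattice) {k : ℕ} (hk : 1 ≤ k)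
    (h₂ : L.g₂ ∈ F) (h₃ : L.g₃ ∈ F) (h₂' : L'.g₂ ∈ F) (h₃' : L'.g₃ ∈ F)
    (hx : ℘[L] z ∈ F) (hy : ℘'[L] z ∈ F) (hx' : ℘[L'] z ∈ F) (hy' : ℘'[L'] z ∈ F)
    (hc : ∀ c ∈ S.erase 0, ℘[L] c ∈ F) :
    (S.card : ℂ) * L.eisensteinE k z - L'.eisensteinE k z ∈ F := by
  have hzL : z ∉ L.lattice := fun h ↦ hz (le_of_reps hS hS0 h)
  rcases Nat.lt_or_ge k 3 with hlt | hge
  · interval_cases k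
    · -- weight one: `Θ′/Θ = 12 (N E₁ − E₁')`
      have h := logDeriv_ellipticTheta hS hS0 hSd hz
      have hmem := logDeriv_ellipticTheta_mem hS hS0 hSd hz hx hy hc
      rw [h] at hmem
      have h12 : (12 : ℂ) ∈ F := by exact_mod_cast natCast_mem F 12
      have := div_mem hmem h12
      rw [mul_div_cancel_left₀ _ (by norm_num : (12 : ℂ) ≠ 0)] at this
      simpa only [eisensteinE_one] using this
    · -- weight two: `N E₂ − E₂' = N℘ − ℘' − Σ'℘(c)`
      rw [eisensteinE_two, eisensteinE_two, s₂_eq_of_reps hS hS0 hSd]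
      have : (S.card : ℂ) * (℘[L] z + L.s₂) - (℘[L'] z + ((S.card : ℂ) * L.s₂ + ∑ c ∈ S.erase 0, ℘[L] c))
          = (S.card : ℂ) * ℘[L] z - ℘[L'] z - ∑ c ∈ S.erase 0, ℘[L] c := by ring
      rw [this]
      exact sub_mem (sub_mem (mul_mem (natCast_mem F _) hx) hx') (sum_mem hc)
  · exact sub_mem (mul_mem (natCast_mem F _)
      ((L.eisensteinE_mem_of_mem hge hzL (F := F.toSubalgebra) h₂ h₃ hx hy)))
      (L'.eisensteinE_mem_of_mem hge hz (F := F.toSubalgebra) h₂' h₃' hx' hy')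

/-- ★ **Every Taylor coefficient of `(d/dz) log Θ(·; L, S)` at `z ∉ Λ'` is `F′`-rational**:
`(d/dz)^m(Θ′/Θ)(z) = 12(−1)^m(N E_{m+1}(z, Λ) − E_{m+1}(z, Λ')) ∈ F′` for all `m` (II.3.1 (7) with
`sub_eisensteinE_mem`) — the elementary core of "`Θ(Ω − z; L, 𝔞)` is defined over `F`, hence
`P(z) ∈ F[[z]]`" (II.4.9) at the level of the logarithmic derivative.
[cite: deShalit1987, II.3.3 (ii), II.4.9] -/
theorem iteratedDeriv_logDeriv_ellipticTheta_mem {z : ℂ} (hz : z ∉ L'.lattice) (m : ℕ)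
    (h₂ : L.g₂ ∈ F) (h₃ : L.g₃ ∈ F) (h₂' : L'.g₂ ∈ F) (h₃' : L'.g₃ ∈ F)
    (hx : ℘[L] z ∈ F) (hy : ℘'[L] z ∈ F) (hx' : ℘[L'] z ∈ F) (hy' : ℘'[L'] z ∈ F)
    (hc : ∀ c ∈ S.erase 0, ℘[L] c ∈ F) :
    iteratedDeriv m (logDeriv (L.ellipticTheta S)) z ∈ F := by
  rw [iteratedDeriv_logDeriv_ellipticTheta hS hS0 hSd m hz]
  refine mul_mem (mul_mem (by exact_mod_cast natCast_mem F 12) (pow_mem (neg_mem (one_mem F)) m)) ?_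
  exact sub_eisensteinE_mem hS hS0 hSd hz (by omega) h₂ h₃ h₂' h₃' hx hy hx' hy' hc

end Reps

/-- The same for de Shalit's `Θ(z; L, 𝔞) = (Δ(L)/Δ(𝔞⁻¹L))·Θ_{L,𝔞}` (`PeriodPair.deShalitTheta`; the
constant prefactor does not affect the logarithmic derivative). [cite: deShalit1987, II.3.3 (ii), II.4.9] -/
theorem iteratedDeriv_logDeriv_deShalitTheta_mem (h : L.IsLatticeReps L' S) {z : ℂ} (hz : z ∉ L'.lattice)
    (m : ℕ) (h₂ : L.g₂ ∈ F) (h₃ : L.g₃ ∈ F) (h₂' : L'.g₂ ∈ F) (h₃' : L'.g₃ ∈ F)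
    (hx : ℘[L] z ∈ F) (hy : ℘'[L] z ∈ F) (hx' : ℘[L'] z ∈ F) (hy' : ℘'[L'] z ∈ F)
    (hc : ∀ c ∈ S.erase 0, ℘[L] c ∈ F) :
    iteratedDeriv m (logDeriv (L.deShalitTheta L' S)) z ∈ F := by
  have hfun : logDeriv (L.deShalitTheta L' S) = logDeriv (L.ellipticTheta S) := by
    funext w
    have hdef : L.deShalitTheta L' S = fun x ↦ L.deltaRatio L' * L.ellipticTheta S x := rfl
    rw [hdef, logDeriv_const_mul w _ (L.deltaRatio_ne_zero L')]
  rw [hfun]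
  exact iteratedDeriv_logDeriv_ellipticTheta_mem h.mem_iff h.zero_mem h.distinct hz m h₂ h₃ h₂' h₃' hx hy
    hx' hy' hc

/-- **Generated-field form**: with `F′ = ℚ(g₂, g₃, g₂′, g₃′, ℘(z), ℘′(z), ℘'(z), ℘'′(z), ℘(c) : c ∈ S ∖ 0)`,
every `(d/dz)^m(Θ′/Θ)(z)` lies in `F′`. [cite: deShalit1987, II.3.3 (ii), II.4.9] -/
theorem iteratedDeriv_logDeriv_ellipticTheta_mem_adjoin (h : L.IsLatticeReps L' S) {z : ℂ}
    (hz : z ∉ L'.lattice) (m : ℕ) :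
    iteratedDeriv m (logDeriv (L.ellipticTheta S)) z ∈
      IntermediateField.adjoin ℚ
        ({L.g₂, L.g₃, L'.g₂, L'.g₃, ℘[L] z, ℘'[L] z, ℘[L'] z, ℘'[L'] z} ∪ ((S.erase 0).image ℘[L] : Set ℂ)) := by
  set T : Set ℂ := {L.g₂, L.g₃, L'.g₂, L'.g₃, ℘[L] z, ℘'[L] z, ℘[L'] z, ℘'[L'] z} ∪
    ((S.erase 0).image ℘[L] : Set ℂ) with hT
  have hsub : T ⊆ IntermediateField.adjoin ℚ T := IntermediateField.subset_adjoin ℚ T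
  have hm : ∀ x, x ∈ T → x ∈ IntermediateField.adjoin ℚ T := fun x hx ↦ hsub hx
  refine iteratedDeriv_logDeriv_ellipticTheta_mem h.mem_iff h.zero_mem h.distinct hz m
    (hm _ (by simp [hT])) (hm _ (by simp [hT])) (hm _ (by simp [hT])) (hm _ (by simp [hT]))
    (hm _ (by simp [hT])) (hm _ (by simp [hT])) (hm _ (by simp [hT])) (hm _ (by simp [hT]))
    (fun c hc ↦ hm _ ?_)
  refine Or.inr ?_
  simp only [Finset.coe_image]
  exact Set.mem_image_of_mem _ hc

/-! ### The form used in II.4.10 (26): derivatives of `log Θ(Ω − z; L, 𝔞)` at `z = v` -/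

section CompSub

variable (hS : ∀ x, x ∈ L'.lattice ↔ ∃ c ∈ S, x - c ∈ L.lattice) (hS0 : (0 : ℂ) ∈ S)
  (hSd : ∀ c ∈ S, ∀ c' ∈ S, c - c' ∈ L.lattice → c = c')
include hS hS0 hSd

/-- ★ **de Shalit II.4.10 (26), complex side: `(d/dz)^m((d/dz) log Θ(Ω − z; L, S))(v) =
−12·(N·E_{m+1}(Ω − v, Λ) − E_{m+1}(Ω − v, Λ'))`** for `Ω − v ∉ Λ'` — i.e. with `k = m + 1`,
`(d/dz)^k log Θ(Ω − z; L, 𝔞)|_{z = v} = −12·E_k(Ω − v; L, 𝔞)` ("`δ_{k,n}(β(𝔞)) = Ω_p^k·(d/dz)^k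
log Θ(Ω − z; L, 𝔞)|_{z=v_n} = −12·Ω_p^k·E_k(Ω − v_n; L, 𝔞)`"): the sign `(−1)^m` of the substitution
`z ↦ Ω − z` cancels the `(−1)^m` of II.3.1 (7). [cite: deShalit1987, II.4.10 (26), II.3.1 (7)] -/
theorem iteratedDeriv_logDeriv_ellipticTheta_comp_sub (Ω : ℂ) (m : ℕ) {v : ℂ} (hv : Ω - v ∉ L'.lattice) :
    iteratedDeriv m (logDeriv (fun z ↦ L.ellipticTheta S (Ω - z))) v =
      -12 * ((S.card : ℂ) * L.eisensteinE (m + 1) (Ω - v) - L'.eisensteinE (m + 1) (Ω - v)) := by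
  -- the logarithmic derivative of `z ↦ Θ(Ω − z)` is `−(Θ′/Θ)(Ω − z)` (everywhere, unconditionally)
  have hlog : logDeriv (fun z ↦ L.ellipticTheta S (Ω - z)) = fun z ↦ -(logDeriv (L.ellipticTheta S) (Ω + -z)) := by
    funext z
    rw [logDeriv_apply, logDeriv_apply, deriv_comp_const_sub, ← sub_eq_add_neg, neg_div]
  rw [hlog, iteratedDeriv_fun_neg, iteratedDeriv_comp_neg m (fun y ↦ logDeriv (L.ellipticTheta S) (Ω + y)) v,
    iteratedDeriv_comp_const_add m (logDeriv (L.ellipticTheta S)) Ω, smul_eq_mul]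
  have hv' : Ω + -v ∉ L'.lattice := by rwa [← sub_eq_add_neg]
  beta_reduce
  rw [iteratedDeriv_logDeriv_ellipticTheta hS hS0 hSd m hv', ← sub_eq_add_neg]
  have h1 : ((-1 : ℂ) ^ m) * (-1) ^ m = 1 := by rw [← mul_pow]; norm_num
  linear_combination (-12 * ((S.card : ℂ) * L.eisensteinE (m + 1) (Ω - v) - L'.eisensteinE (m + 1) (Ω - v))) * h1

end CompSub

/-- The same for de Shalit's `Θ(z; L, 𝔞) = PeriodPair.deShalitTheta L L' S` (constant prefactor):
`(d/dz)^m((d/dz) log Θ(Ω − ·; L, 𝔞))(v) = −12·(N𝔞·E_{m+1}(Ω − v, L) − E_{m+1}(Ω − v, 𝔞⁻¹L))`.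
[cite: deShalit1987, II.4.10 (26)] -/
theorem iteratedDeriv_logDeriv_deShalitTheta_comp_sub (h : L.IsLatticeReps L' S) (Ω : ℂ) (m : ℕ) {v : ℂ}
    (hv : Ω - v ∉ L'.lattice) :
    iteratedDeriv m (logDeriv (fun z ↦ L.deShalitTheta L' S (Ω - z))) v =
      -12 * ((S.card : ℂ) * L.eisensteinE (m + 1) (Ω - v) - L'.eisensteinE (m + 1) (Ω - v)) := by
  have hfun : logDeriv (fun z ↦ L.deShalitTheta L' S (Ω - z)) =
      logDeriv (fun z ↦ L.ellipticTheta S (Ω - z)) := by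
    funext w
    have hdef : (fun z ↦ L.deShalitTheta L' S (Ω - z)) =
        fun z ↦ L.deltaRatio L' * L.ellipticTheta S (Ω - z) := rfl
    rw [hdef, logDeriv_const_mul w _ (L.deltaRatio_ne_zero L')]
  rw [hfun, iteratedDeriv_logDeriv_ellipticTheta_comp_sub h.mem_iff h.zero_mem h.distinct Ω m hv]

end PeriodPair


end
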